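import Literature.MathematicalPhysics.QuantumFieldTheory.Balaban1983to89.HaarAnalyticZeroSetNull
import Literature.MathematicalPhysics.QuantumFieldTheory.Balaban1983to89.ExpSurjectiveConnectedSubgroup
import Literature.MathematicalPhysics.QuantumFieldTheory.Balaban1983to89.B12SpecialUnitaryClosedSubgroup
import Literature.MathematicalPhysics.QuantumFieldTheory.Balaban1983to89.UnitaryModel
import Literature.LinearAlgebra.Matrix.UnitaryGramSchmidtRetraction
import Mathlib.Analysis.CStarAlgebra.Spectrum
import Mathlib.LinearAlgebra.Matrix.MvPolynomial
import Mathlib.Analysis.Analytic.Polynomial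

/-!
# `Balaban1983to89.HaarEigenvalueSphereNull` — EIGENVALUE HYPERSURFACES `{g : λ ∈ σ(g)}` AND THE `|g − 1|`-SPHERES
# `{g : ‖g − 1‖ = r}` (`r ≠ 0`) ARE HAAR-NULL in every closed `G ≤ U(N)` onto which `exp : 𝐠 → G` maps, in `U(N)`, and in `SU(N)`

Kernel measure theory on the cell's gauge groups, tags **[folklore]** ∕ [BrockerTomDieck1985] IV (2.11) (proof principle); nothing of
Bałaban's analysis is asserted.  Cell `pub-ymgap` (YM-PLAN Track A, DAG node N09 [Balaban1987RG1]; seat `pub-ymgap-dag-n09-w1` g4),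
count-neutral helper keyed to K1⁷ `stmt-QuantumFields-20542`.

WHY (the located debt this serves).  Seat `pub-ymgap-node00-def-K0e`'s audit `P7-LOCATOR-AUDIT.md` §4 lists, among the three standard-analysis
inputs (F1)–(F3) behind the β-version proviso `contT`∕`contTOn` of the record (N09's analytic binder `hreg` in the list of record of
`BalabanUVNodesN09AtSmallFieldBookkeeping`), the item **(F2) LEVEL-SET NULLITY: `Haar{g ∈ SU(N) : dist1 g = r} = 0` for `r > 0`**
(«needed because the SHARP `𝟙_{domAlt_k}` is integrated over fibres»; `dist1 g = ‖g − 1‖` in the L²-operator norm, [Balaban1985Averaging]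
(19) p. 21, `UnitaryModel`).  This file proves that sentence (§3), in the generality in which the lit-balaban lineage's zero-set engine gives
it (§2), from one spectral bookkeeping lemma (§1).  The FIBRE-measure reading of (F2) (conditional law of the fine field given its block
average) is NOT addressed here — it needs (F1), the Jacobian face of (0.4); see HONEST SCOPE.

THE ARGUMENT.  For a unitary matrix `u`, `u − 1` is normal, so `‖u − 1‖` (L²-operator norm) is its spectral radius
(Mathlib `IsStarNormal.spectralRadius_eq_nnnorm` in the C⋆-algebra `M_N(ℂ)`), attained at some `λ − 1`, `λ ∈ σ(u) ⊆ S¹`; the set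
`{λ : ‖λ‖ = 1, ‖λ − 1‖ = r}` has at most two points; hence `{‖u − 1‖ = r} ⊆ ⋃_{≤ 2 points λ ≠ 1} {λ ∈ σ(u)}`, and `{g : λ ∈ σ(g)}` is the zero
set of the real-analytic `M ↦ det(λ·1 − M)`, not identically zero on `G` (at `g = 1` when `λ ≠ 1`), so Haar-null by the lineage's
`HaarAnalyticZeroSetNull.haar_zeroSet_eq_zero` ([BrockerTomDieck1985] IV (2.11), printed proof principle; Mityagin's zero-set theorem).
The TYPES `Matrix.unitaryGroup (Fin N) ℂ` and `Matrix.specialUnitaryGroup n ℂ` are reached by transporting Haar measures along the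
homeomorphic group isomorphisms `U(N) ≃* ⊤` and `SU(n) ≃* specialUnitarySubgroup n` (Mathlib `MulEquiv.isHaarMeasure_map`).

WHAT IS PROVED (theorems only; 0 definitions; 0 sorry; axioms standard; the `[folklore]` matrix∕plumbing helpers are `private`).
* §1 (private) `det_algebraMap_sub_eq_zero_iff` (`det(λ·1 − M) = 0 ↔ λ ∈ σ(M)`), `analyticOnNhd_det`, `analyticOnNhd_det_algebraMap_sub`,
  `det_algebraMap_sub_one` (`det(λ·1 − 1) = (λ − 1)^N`), `eq_or_eq_of_norm_eq_one_of_norm_sub_one_eq` ∕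
  `finite_setOf_norm_eq_one_and_norm_sub_one_eq` (the two-point set `{‖λ‖ = 1, ‖λ − 1‖ = r}`); PUBLIC ★ `exists_mem_spectrum_norm_sub_one_eq`
  (`u ∈ U(n)`, `n ≠ ∅`: `∃ λ ∈ σ(u), ‖λ‖ = 1 ∧ ‖λ − 1‖ = ‖u − 1‖` — print's «operator norm» of `U − 1` read on the spectrum).
* §2 closed `G ≤ U(n)` with `Θ_G` onto, every Haar `μ`: ★ `haar_setOf_mem_spectrum_eq_zero` (`μ{g : λ ∈ σ(g)} = 0` given ONE `g₀ ∈ G` with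
  `λ ∉ σ(g₀)`), `haar_setOf_mem_spectrum_eq_zero_of_ne_one` (`λ ≠ 1`, witness `1`), ★★ `haar_setOf_norm_sub_one_eq_eq_zero`
  (`μ{g : ‖g − 1‖ = r} = 0`, `r ≠ 0`), `ae_norm_sub_one_ne`.
* §3 the cell's types: `haar_unitaryGroup_setOf_norm_sub_one_eq_eq_zero` (`U(N)`, `Fin N`), `haar_specialUnitaryGroup_setOf_mem_spectrum_eq_zero_of_ne_one`,
  ★★ `haar_specialUnitaryGroup_setOf_norm_sub_one_eq_eq_zero` (`SU(n)`, every Haar `μ`), and in the `GaugeGroup`∕`HaarData` currency of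
  `UnitaryModel` (`dist1 g = ‖g − 1‖`, `HaarData.haar = haarProbability`): ★★★ `haar_setOf_dist1_eq_eq_zero_specialUnitaryGroup :
  (HaarData.haar : Measure SU(n)) {g | dist1 g = r} = 0` (`r ≠ 0`) — the audit's (F2) sentence —, `ae_dist1_ne_specialUnitaryGroup`,
  `haar_setOf_dist1_eq_eq_zero_unitaryGroup`.

HONEST SCOPE.  (i) Only `r ≠ 0`: `{‖g − 1‖ = 0} = {1}` is an atom question (null too for non-discrete `G`, not needed, not stated).
(ii) For `λ = 1` on `SU(1) = {1}` the eigenvalue statement is false, whence the witness hypothesis in §2∕§3.  (iii) Everything group-level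
goes through the lineage's landed engine BY NAME (`HaarAnalyticZeroSetNull`, `ExpSurjectiveConnectedSubgroup`, `B12SpecialUnitaryClosedSubgroup`,
`UnitaryGramSchmidtRetraction.pathConnectedSpace_unitaryGroup`); nothing of it is re-proved.  (iv) NOT HERE: the fibre∕conditional-law
form of (F2), (F1) (Jacobian face of (0.4)), (F3) (positivity) — the β-version proviso of the record stays displayed; nothing of Bałaban
asserted; N09 NOT discharged; the YM mass gap (Clay) is NOT proved by any of this (R4 = conditional finite-𝕋⁴ rung `BalabanLadder.UV` only).

References: Th. Bröcker, T. tom Dieck, *Representations of Compact Lie Groups*, GTM 98 (1985) [BrockerTomDieck1985] IV (2.11);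
T. Bałaban, Commun. Math. Phys. **98** (1985) 17–51 [Balaban1985Averaging] (19) p. 21 (`|U − 1|` = operator norm); Commun. Math. Phys. **109**
(1987) 249–301 [Balaban1987RG1] p. 259 (the sharp small-field domain `|∂V − 1| < ε₀`).
-/

noncomputable section

open NormedSpace Set Function Filter Topology MeasureTheory Complex
open scoped ENNReal NNReal Matrix.Norms.L2Operator Pointwise

namespace Literature.MathematicalPhysics.QuantumFieldTheory.Balaban1983to89.HaarEigenvalueSphereNull

open HaarExponentialChart HaarExponentialChart.IsChartRep
open LogChartClosedSubgroup (unitarySubgroupLogChart)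
open ExpSurjectiveConnectedSubgroup (expChart_surjective)
open B12SpecialUnitaryClosedSubgroup (specialUnitarySubgroup isClosed_specialUnitarySubgroup isConnected_specialUnitarySubgroup
  coe_mem_specialUnitaryGroup_iff)

variable {n : Type*} [Fintype n] [DecidableEq n]

/-! ## §1 Spectral bookkeeping in `M_N(ℂ)` (L²-operator norm) -/

section Spectral

/-- `det(λ·1 − M) = 0 ⟺ λ ∈ σ(M)` (a matrix over `ℂ` is a unit iff its determinant is). [folklore] -/
private theorem det_algebraMap_sub_eq_zero_iff (z : ℂ) (M : Matrix n n ℂ) :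
    (algebraMap ℂ (Matrix n n ℂ) z - M).det = 0 ↔ z ∈ spectrum ℂ M := by
  rw [spectrum.mem_iff, Matrix.isUnit_iff_isUnit_det, isUnit_iff_ne_zero, not_not]

/-- `det M` is the evaluation at the entries of `M` of the determinant of the generic matrix `(X_{ij})`. [folklore] -/
private theorem det_eq_eval_mvPolynomialX (M : Matrix n n ℂ) :
    M.det = MvPolynomial.eval (fun p : n × n => M p.1 p.2) (Matrix.mvPolynomialX n n ℂ).det := by
  rw [RingHom.map_det, Matrix.mvPolynomialX_mapMatrix_eval]

/-- `det` is (complex-)analytic on `M_N(ℂ)` (a polynomial in the entries; the pattern of `HaarNegOneEigenvalueNull` §1, whose lemma is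
private there). [folklore] -/
private theorem analyticOnNhd_det : AnalyticOnNhd ℂ (fun M : Matrix n n ℂ => M.det) Set.univ := by
  let e : Matrix n n ℂ →L[ℂ] (n × n → ℂ) :=
    LinearMap.toContinuousLinearMap
      { toFun := fun A p => A p.1 p.2
        map_add' := fun _ _ => rfl
        map_smul' := fun _ _ => rfl }
  have h := AnalyticOnNhd.eval_continuousLinearMap e (Matrix.mvPolynomialX n n ℂ).det
  have heq : (fun M : Matrix n n ℂ => M.det) = fun M => MvPolynomial.eval (e M) (Matrix.mvPolynomialX n n ℂ).det :=
    funext fun M => det_eq_eval_mvPolynomialX M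
  rw [heq]; exact h

/-- `M ↦ det(λ·1 − M)` is real-analytic on `M_N(ℂ)`. [folklore] -/
private theorem analyticOnNhd_det_algebraMap_sub (z : ℂ) :
    AnalyticOnNhd ℝ (fun M : Matrix n n ℂ => (algebraMap ℂ (Matrix n n ℂ) z - M).det) Set.univ := by
  intro M _
  have h1 : AnalyticAt ℂ (fun Y : Matrix n n ℂ => algebraMap ℂ (Matrix n n ℂ) z - Y) M :=
    analyticAt_const.sub analyticAt_id
  exact ((analyticOnNhd_det _ (Set.mem_univ _)).comp h1).restrictScalars

/-- `det(λ·1 − 1) = (λ − 1)^N`. [folklore] -/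
private theorem det_algebraMap_sub_one (z : ℂ) :
    (algebraMap ℂ (Matrix n n ℂ) z - 1).det = (z - 1) ^ Fintype.card n := by
  rw [← map_one (algebraMap ℂ (Matrix n n ℂ)), ← map_sub, Matrix.algebraMap_eq_diagonal, Matrix.det_diagonal]
  simp [Finset.prod_const, Finset.card_univ]

/-- `λ ∉ σ(1)` for `λ ≠ 1` (no non-triviality hypothesis: via the determinant). [folklore] -/
private theorem not_mem_spectrum_one {z : ℂ} (hz : z ≠ 1) : z ∉ spectrum ℂ (1 : Matrix n n ℂ) := by
  rw [← det_algebraMap_sub_eq_zero_iff, det_algebraMap_sub_one]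
  exact pow_ne_zero _ (sub_ne_zero.2 hz)

/-- **THE NORM `‖u − 1‖` OF A UNITARY MATRIX IS ATTAINED ON THE SPECTRUM**: for `u ∈ U(n)` (`n ≠ ∅`) there is `λ ∈ σ(u)` with
`‖λ‖ = 1` and `‖λ − 1‖ = ‖u − 1‖` (`u − 1` is normal, its L²-operator norm is its spectral radius — print's «|U − 1| … operator norm»,
i.e. `max_j |λ_j − 1|`). [cite: Balaban1985Averaging, (19) p.21] -/
theorem exists_mem_spectrum_norm_sub_one_eq [Nonempty n] (u : Matrix.unitaryGroup n ℂ) :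
    ∃ z ∈ spectrum ℂ (u : Matrix n n ℂ), ‖z‖ = 1 ∧ ‖z - 1‖ = ‖(u : Matrix n n ℂ) - 1‖ := by
  letI : CStarAlgebra (Matrix n n ℂ) := {}
  set a : Matrix n n ℂ := (u : Matrix n n ℂ) - 1 with ha
  have hcomm : Commute (star (u : Matrix n n ℂ)) (u : Matrix n n ℂ) :=
    (Unitary.coe_isStarNormal u).star_comm_self
  haveI : IsStarNormal a := by
    refine ⟨?_⟩
    rw [ha, star_sub, star_one]
    exact (hcomm.sub_right (Commute.one_right _)).sub_left (Commute.one_left _)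
  have hrad : spectralRadius ℂ a = ‖a‖₊ := IsStarNormal.spectralRadius_eq_nnnorm a
  obtain ⟨k, hk, hkrad⟩ := spectrum.exists_nnnorm_eq_spectralRadius_of_nonempty (spectrum.nonempty a)
  have hk' : k + 1 ∈ spectrum ℂ (u : Matrix n n ℂ) := by
    have hmem : k + 1 ∈ spectrum ℂ a + ({(1 : ℂ)} : Set ℂ) := Set.add_mem_add hk (Set.mem_singleton 1)
    rw [spectrum.add_singleton_eq, map_one, ha, sub_add_cancel] at hmem
    exact hmem
  refine ⟨k + 1, hk', spectrum.norm_eq_one_of_unitary u.2 hk', ?_⟩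
  rw [add_sub_cancel_right]
  have h1 : (‖k‖₊ : ℝ≥0∞) = ‖a‖₊ := by rw [hkrad, hrad]
  have h2 : ‖k‖₊ = ‖a‖₊ := by exact_mod_cast h1
  rw [← coe_nnnorm, ← coe_nnnorm, h2]

/-- **AT MOST TWO UNIT COMPLEX NUMBERS AT A GIVEN DISTANCE FROM `1`**: `‖z‖ = 1` and `‖z − 1‖ = r` force `Re z = 1 − r²/2` and
`Im z = ±√(1 − (1 − r²/2)²)`. [folklore] -/
private theorem eq_or_eq_of_norm_eq_one_of_norm_sub_one_eq {z : ℂ} {r : ℝ} (h1 : ‖z‖ = 1) (hr : ‖z - 1‖ = r) :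
    z = ⟨1 - r ^ 2 / 2, Real.sqrt (1 - (1 - r ^ 2 / 2) ^ 2)⟩ ∨
      z = ⟨1 - r ^ 2 / 2, -Real.sqrt (1 - (1 - r ^ 2 / 2) ^ 2)⟩ := by
  have e1 : z.re ^ 2 + z.im ^ 2 = 1 := by
    have := Complex.sq_norm z
    rw [Complex.normSq_apply, h1] at this
    nlinarith [this]
  have e2 : (z.re - 1) ^ 2 + z.im ^ 2 = r ^ 2 := by
    have := Complex.sq_norm (z - 1)
    rw [Complex.normSq_apply, hr] at this
    simp only [Complex.sub_re, Complex.one_re, Complex.sub_im, Complex.one_im, sub_zero] at this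
    nlinarith [this]
  have hre : z.re = 1 - r ^ 2 / 2 := by nlinarith [e1, e2]
  have him : z.im ^ 2 = 1 - (1 - r ^ 2 / 2) ^ 2 := by rw [← hre]; linarith [e1]
  have habs : |z.im| = Real.sqrt (1 - (1 - r ^ 2 / 2) ^ 2) := by
    rw [← him, Real.sqrt_sq_eq_abs]
  rcases abs_eq_abs.1 (habs.trans (abs_of_nonneg (Real.sqrt_nonneg _)).symm) with h | h
  · exact Or.inl (Complex.ext hre h)
  · exact Or.inr (Complex.ext hre h)

/-- The set `{z : ‖z‖ = 1 ∧ ‖z − 1‖ = r}` is finite (at most two points). [folklore] -/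
private theorem finite_setOf_norm_eq_one_and_norm_sub_one_eq (r : ℝ) : {z : ℂ | ‖z‖ = 1 ∧ ‖z - 1‖ = r}.Finite := by
  refine (Set.toFinite ({(⟨1 - r ^ 2 / 2, Real.sqrt (1 - (1 - r ^ 2 / 2) ^ 2)⟩ : ℂ),
    (⟨1 - r ^ 2 / 2, -Real.sqrt (1 - (1 - r ^ 2 / 2) ^ 2)⟩ : ℂ)} : Set ℂ)).subset fun z hz => ?_
  rcases eq_or_eq_of_norm_eq_one_of_norm_sub_one_eq hz.1 hz.2 with h | h
  · exact Or.inl h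
  · exact Or.inr h

end Spectral

/-! ## §2 Closed `G ≤ U(N)` onto which `Θ_G : 𝐠 → G` maps: eigenvalue hypersurfaces and `|g − 1|`-spheres are Haar-null -/

section Subgroup

variable (Gs : Subgroup (Matrix.unitaryGroup n ℂ)) (hG : IsClosed (Gs : Set (Matrix.unitaryGroup n ℂ)))
  (μ : Measure Gs) [μ.IsHaarMeasure]

/-- **`μ{g ∈ G : λ ∈ σ(g)} = 0`** for every closed `G ≤ U(N)` with `Θ_G` onto, every Haar measure `μ`, and every `λ` that is NOT an
eigenvalue of at least one `g₀ ∈ G` (the zero set of the real-analytic `M ↦ det(λ·1 − M)`, the lineage's `haar_zeroSet_eq_zero`).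
[cite: BrockerTomDieck1985, IV (2.11) (proof)] -/
theorem haar_setOf_mem_spectrum_eq_zero (hsurj : Function.Surjective (isChartRep_unitarySubgroup Gs hG).expChart) (z : ℂ)
    (hne : ∃ g₀ : Gs, z ∉ spectrum ℂ (((g₀ : Gs) : Matrix.unitaryGroup n ℂ) : Matrix n n ℂ)) :
    μ {g : Gs | z ∈ spectrum ℂ (((g : Gs) : Matrix.unitaryGroup n ℂ) : Matrix n n ℂ)} = 0 := by
  have h := HaarAnalyticZeroSetNull.haar_zeroSet_eq_zero Gs hG (analyticOnNhd_det_algebraMap_sub z) μ hsurj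
    (by obtain ⟨g₀, hg₀⟩ := hne; exact ⟨g₀, fun h0 => hg₀ ((det_algebraMap_sub_eq_zero_iff z _).1 h0)⟩)
  simp only [det_algebraMap_sub_eq_zero_iff] at h
  exact h

/-- **`μ{g ∈ G : λ ∈ σ(g)} = 0` for every `λ ≠ 1`** (witness `g₀ = 1`). [cite: BrockerTomDieck1985, IV (2.11) (proof)] -/
theorem haar_setOf_mem_spectrum_eq_zero_of_ne_one (hsurj : Function.Surjective (isChartRep_unitarySubgroup Gs hG).expChart)
    {z : ℂ} (hz : z ≠ 1) :
    μ {g : Gs | z ∈ spectrum ℂ (((g : Gs) : Matrix.unitaryGroup n ℂ) : Matrix n n ℂ)} = 0 :=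
  haar_setOf_mem_spectrum_eq_zero Gs hG μ hsurj z ⟨1, by
    simpa only [OneMemClass.coe_one] using not_mem_spectrum_one (n := n) hz⟩

/-- **THE `|g − 1|`-SPHERES ARE HAAR-NULL: `μ{g ∈ G : ‖g − 1‖ = r} = 0` for every `r ≠ 0`**, every closed `G ≤ U(N)` with `Θ_G` onto and
every Haar measure `μ` on `G` (the sphere is covered by at most two eigenvalue hypersurfaces `{λ ∈ σ(g)}`, `λ ≠ 1`, §1).
[cite: BrockerTomDieck1985, IV (2.11) (proof)] [cite: Balaban1985Averaging, (19) p.21] -/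
theorem haar_setOf_norm_sub_one_eq_eq_zero (hsurj : Function.Surjective (isChartRep_unitarySubgroup Gs hG).expChart)
    {r : ℝ} (hr : r ≠ 0) :
    μ {g : Gs | ‖(((g : Gs) : Matrix.unitaryGroup n ℂ) : Matrix n n ℂ) - 1‖ = r} = 0 := by
  rcases isEmpty_or_nonempty n with hn | hn
  · -- `M_∅(ℂ)` is trivial: `‖g − 1‖ = 0 ≠ r`, the set is empty
    have hempty : {g : Gs | ‖(((g : Gs) : Matrix.unitaryGroup n ℂ) : Matrix n n ℂ) - 1‖ = r} = ∅ := by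
      ext g
      simp only [Set.mem_setOf_eq, Set.mem_empty_iff_false, iff_false]
      rw [Subsingleton.elim ((((g : Gs) : Matrix.unitaryGroup n ℂ) : Matrix n n ℂ) - 1) 0, norm_zero]
      exact fun h => hr h.symm
    rw [hempty, measure_empty]
  · set S : Set ℂ := {z : ℂ | ‖z‖ = 1 ∧ ‖z - 1‖ = r} with hS
    have hSc : S.Countable := (finite_setOf_norm_eq_one_and_norm_sub_one_eq r).countable
    have hsub : {g : Gs | ‖(((g : Gs) : Matrix.unitaryGroup n ℂ) : Matrix n n ℂ) - 1‖ = r} ⊆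
        ⋃ z ∈ S, {g : Gs | z ∈ spectrum ℂ (((g : Gs) : Matrix.unitaryGroup n ℂ) : Matrix n n ℂ)} := by
      intro g hg
      obtain ⟨z, hz, hz1, hzr⟩ := exists_mem_spectrum_norm_sub_one_eq ((g : Gs) : Matrix.unitaryGroup n ℂ)
      rw [Set.mem_setOf_eq] at hg
      exact Set.mem_iUnion₂.2 ⟨z, ⟨hz1, hzr.trans hg⟩, hz⟩
    refine measure_mono_null hsub ((measure_biUnion_null_iff hSc).2 fun z hz => ?_)
    have hz1 : z ≠ 1 := by
      intro h
      have h2 := hz.2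
      rw [h, sub_self, norm_zero] at h2
      exact hr h2.symm
    exact haar_setOf_mem_spectrum_eq_zero_of_ne_one Gs hG μ hsurj hz1

/-- Almost-everywhere form: `μ`-a.e. `g ∈ G` has `‖g − 1‖ ≠ r` (`r ≠ 0`). [cite: BrockerTomDieck1985, IV (2.11) (proof)] -/
theorem ae_norm_sub_one_ne (hsurj : Function.Surjective (isChartRep_unitarySubgroup Gs hG).expChart) {r : ℝ} (hr : r ≠ 0) :
    ∀ᵐ g ∂μ, ‖(((g : Gs) : Matrix.unitaryGroup n ℂ) : Matrix n n ℂ) - 1‖ ≠ r := by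
  rw [ae_iff]
  simpa only [not_not] using haar_setOf_norm_sub_one_eq_eq_zero Gs hG μ hsurj hr

/-- TRANSPORT TO A TYPE: if `e : H ≃* G` is a homeomorphic group isomorphism onto the closed subgroup `G ≤ U(N)`, a matrix-level
statement `μ{g ∈ G : (g : M_N(ℂ)) ∈ S} = 0` for every Haar `μ` on `G` gives `ν{h : (e h : M_N(ℂ)) ∈ S} = 0` for every Haar `ν` on `H`
(Mathlib `MulEquiv.isHaarMeasure_map`). [folklore] -/
private theorem measure_setOf_mulEquiv_eq_zero {H : Type*} [Group H] [TopologicalSpace H] [IsTopologicalGroup H] [MeasurableSpace H]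
    [BorelSpace H] (e : H ≃* Gs) (he : Continuous e) (hes : Continuous e.symm) (ν : Measure H) [ν.IsHaarMeasure]
    {S : Set (Matrix n n ℂ)} (hS : MeasurableSet {g : Gs | (((g : Gs) : Matrix.unitaryGroup n ℂ) : Matrix n n ℂ) ∈ S})
    (h0 : ∀ μ : Measure Gs, μ.IsHaarMeasure → μ {g : Gs | (((g : Gs) : Matrix.unitaryGroup n ℂ) : Matrix n n ℂ) ∈ S} = 0) :
    ν {h : H | ((((e h : Gs)) : Matrix.unitaryGroup n ℂ) : Matrix n n ℂ) ∈ S} = 0 := by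
  haveI : (ν.map e).IsHaarMeasure := e.isHaarMeasure_map ν he hes
  have h := h0 (ν.map e) inferInstance
  rw [Measure.map_apply he.measurable hS] at h
  exact h

end Subgroup

/-! ## §3 The cell's types `U(N)` and `SU(n)`; the `GaugeGroup` ∕ `HaarData` currency of `UnitaryModel` -/

section Types

/-- `{g ∈ G : ‖g − 1‖ = r}` is closed, hence Borel, in every closed `G ≤ U(N)`. [folklore] -/
private theorem measurableSet_setOf_norm_sub_one_eq (Gs : Subgroup (Matrix.unitaryGroup n ℂ)) (r : ℝ) :
    MeasurableSet {g : Gs | (((g : Gs) : Matrix.unitaryGroup n ℂ) : Matrix n n ℂ) ∈ {M : Matrix n n ℂ | ‖M - 1‖ = r}} :=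
  (isClosed_eq ((continuous_subtype_val.comp continuous_subtype_val).sub continuous_const).norm continuous_const).measurableSet

/-- `{g ∈ G : λ ∈ σ(g)}` is closed, hence Borel, in every closed `G ≤ U(N)`. [folklore] -/
private theorem measurableSet_setOf_mem_spectrum (Gs : Subgroup (Matrix.unitaryGroup n ℂ)) (z : ℂ) :
    MeasurableSet {g : Gs | (((g : Gs) : Matrix.unitaryGroup n ℂ) : Matrix n n ℂ) ∈ {M : Matrix n n ℂ | z ∈ spectrum ℂ M}} := by
  have h : {g : Gs | (((g : Gs) : Matrix.unitaryGroup n ℂ) : Matrix n n ℂ) ∈ {M : Matrix n n ℂ | z ∈ spectrum ℂ M}} =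
      {g : Gs | (algebraMap ℂ (Matrix n n ℂ) z - (((g : Gs) : Matrix.unitaryGroup n ℂ) : Matrix n n ℂ)).det = 0} := by
    ext g; simp only [Set.mem_setOf_eq, det_algebraMap_sub_eq_zero_iff]
  rw [h]
  exact (isClosed_eq ((continuous_const.sub (continuous_subtype_val.comp continuous_subtype_val)).matrix_det)
    continuous_const).measurableSet

/-- **`U(N)`: `μ{u ∈ U(N) : ‖u − 1‖ = r} = 0`** for every Haar measure `μ` on `Matrix.unitaryGroup (Fin N) ℂ` and every `r ≠ 0`
(`U(N)` is connected — the tree's `pathConnectedSpace_unitaryGroup` —, so §2 applies to `G = ⊤`; transport along `U(N) ≃* ⊤`).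
[cite: BrockerTomDieck1985, IV (2.11) (proof)] [cite: Balaban1985Averaging, (19) p.21] -/
theorem haar_unitaryGroup_setOf_norm_sub_one_eq_eq_zero {N : ℕ} (μ : Measure (Matrix.unitaryGroup (Fin N) ℂ)) [μ.IsHaarMeasure]
    {r : ℝ} (hr : r ≠ 0) :
    μ {u : Matrix.unitaryGroup (Fin N) ℂ | ‖(u : Matrix (Fin N) (Fin N) ℂ) - 1‖ = r} = 0 := by
  set Gs : Subgroup (Matrix.unitaryGroup (Fin N) ℂ) := ⊤ with hGs
  have hG : IsClosed (Gs : Set (Matrix.unitaryGroup (Fin N) ℂ)) := by rw [hGs, Subgroup.coe_top]; exact isClosed_univ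
  have hconn : IsConnected (Gs : Set (Matrix.unitaryGroup (Fin N) ℂ)) := by rw [hGs, Subgroup.coe_top]; exact isConnected_univ
  let e : Matrix.unitaryGroup (Fin N) ℂ ≃* Gs := (Subgroup.topEquiv : Gs ≃* Matrix.unitaryGroup (Fin N) ℂ).symm
  have he : Continuous e := Continuous.subtype_mk continuous_id _
  have hes : Continuous e.symm := continuous_subtype_val
  exact measure_setOf_mulEquiv_eq_zero Gs e he hes μ (measurableSet_setOf_norm_sub_one_eq Gs r)
    fun μ' _ => haar_setOf_norm_sub_one_eq_eq_zero Gs hG μ' (expChart_surjective Gs hG hconn) hr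

/-- **`SU(n)`: `μ{g ∈ SU(n) : λ ∈ σ(g)} = 0` for every `λ ≠ 1`** and every Haar measure `μ` on `Matrix.specialUnitaryGroup n ℂ`
(`SU(n) ≤ U(n)` closed connected — `B12SpecialUnitaryClosedSubgroup` —; transport along `SU(n) ≃* specialUnitarySubgroup n`).
[cite: BrockerTomDieck1985, IV (2.11) (proof)] -/
theorem haar_specialUnitaryGroup_setOf_mem_spectrum_eq_zero_of_ne_one [Nonempty n] (μ : Measure (Matrix.specialUnitaryGroup n ℂ))
    [μ.IsHaarMeasure] {z : ℂ} (hz : z ≠ 1) :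
    μ {g : Matrix.specialUnitaryGroup n ℂ | z ∈ spectrum ℂ (g : Matrix n n ℂ)} = 0 := by
  let e : Matrix.specialUnitaryGroup n ℂ ≃* specialUnitarySubgroup n :=
    { toFun := fun g => ⟨⟨(g : Matrix n n ℂ), (Matrix.mem_specialUnitaryGroup_iff.1 g.2).1⟩, coe_mem_specialUnitaryGroup_iff.1 g.2⟩
      invFun := fun u => ⟨((u : Matrix.unitaryGroup n ℂ) : Matrix n n ℂ), coe_mem_specialUnitaryGroup_iff.2 u.2⟩
      left_inv := fun _ => Subtype.ext rfl
      right_inv := fun _ => Subtype.ext (Subtype.ext rfl)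
      map_mul' := fun _ _ => Subtype.ext (Subtype.ext rfl) }
  have he : Continuous e := Continuous.subtype_mk (Continuous.subtype_mk continuous_subtype_val _) _
  have hes : Continuous e.symm := Continuous.subtype_mk (continuous_subtype_val.comp continuous_subtype_val) _
  exact measure_setOf_mulEquiv_eq_zero (specialUnitarySubgroup n) e he hes μ (measurableSet_setOf_mem_spectrum _ z)
    fun μ' _ => haar_setOf_mem_spectrum_eq_zero_of_ne_one (specialUnitarySubgroup n) (isClosed_specialUnitarySubgroup n) μ'
      (expChart_surjective _ _ (isConnected_specialUnitarySubgroup n)) hz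

/-- **`SU(n)`: `μ{g ∈ SU(n) : ‖g − 1‖ = r} = 0`** for every Haar measure `μ` on `Matrix.specialUnitaryGroup n ℂ` and every `r ≠ 0`.
[cite: BrockerTomDieck1985, IV (2.11) (proof)] [cite: Balaban1985Averaging, (19) p.21] -/
theorem haar_specialUnitaryGroup_setOf_norm_sub_one_eq_eq_zero (μ : Measure (Matrix.specialUnitaryGroup n ℂ)) [μ.IsHaarMeasure]
    {r : ℝ} (hr : r ≠ 0) :
    μ {g : Matrix.specialUnitaryGroup n ℂ | ‖(g : Matrix n n ℂ) - 1‖ = r} = 0 := by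
  rcases isEmpty_or_nonempty n with hn | hn
  · have hempty : {g : Matrix.specialUnitaryGroup n ℂ | ‖(g : Matrix n n ℂ) - 1‖ = r} = ∅ := by
      ext g
      simp only [Set.mem_setOf_eq, Set.mem_empty_iff_false, iff_false]
      rw [Subsingleton.elim ((g : Matrix n n ℂ) - 1) 0, norm_zero]
      exact fun h => hr h.symm
    rw [hempty, measure_empty]
  let e : Matrix.specialUnitaryGroup n ℂ ≃* specialUnitarySubgroup n :=
    { toFun := fun g => ⟨⟨(g : Matrix n n ℂ), (Matrix.mem_specialUnitaryGroup_iff.1 g.2).1⟩, coe_mem_specialUnitaryGroup_iff.1 g.2⟩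
      invFun := fun u => ⟨((u : Matrix.unitaryGroup n ℂ) : Matrix n n ℂ), coe_mem_specialUnitaryGroup_iff.2 u.2⟩
      left_inv := fun _ => Subtype.ext rfl
      right_inv := fun _ => Subtype.ext (Subtype.ext rfl)
      map_mul' := fun _ _ => Subtype.ext (Subtype.ext rfl) }
  have he : Continuous e := Continuous.subtype_mk (Continuous.subtype_mk continuous_subtype_val _) _
  have hes : Continuous e.symm := Continuous.subtype_mk (continuous_subtype_val.comp continuous_subtype_val) _
  exact measure_setOf_mulEquiv_eq_zero (specialUnitarySubgroup n) e he hes μ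
    (measurableSet_setOf_norm_sub_one_eq (specialUnitarySubgroup n) r)
    fun μ' _ => haar_setOf_norm_sub_one_eq_eq_zero (specialUnitarySubgroup n) (isClosed_specialUnitarySubgroup n) μ'
      (expChart_surjective _ _ (isConnected_specialUnitarySubgroup n)) hr

/-- **(F2) OF THE P7 LOCATOR AUDIT, VERBATIM: `Haar{g ∈ SU(n) : dist1 g = r} = 0` for `r ≠ 0`** — in the cell's `GaugeGroup`∕`HaarData`
currency of `UnitaryModel` (`dist1 g = ‖g − 1‖_{L²-op}`, `HaarData.haar = haarProbability SU(n)` = normalised Haar measure).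
[cite: Balaban1985Averaging, (19) p.21] [cite: BrockerTomDieck1985, IV (2.11) (proof)] -/
theorem haar_setOf_dist1_eq_eq_zero_specialUnitaryGroup [Nonempty n] {r : ℝ} (hr : r ≠ 0) :
    (HaarData.haar : Measure (Matrix.specialUnitaryGroup n ℂ)) {g | dist1 g = r} = 0 := by
  haveI : (HaarData.haar : Measure (Matrix.specialUnitaryGroup n ℂ)).IsHaarMeasure := Measure.isHaarMeasure_haarMeasure _
  exact haar_specialUnitaryGroup_setOf_norm_sub_one_eq_eq_zero _ hr

/-- Almost-everywhere form on `SU(n)`: Haar-a.e. `dist1 g ≠ r` (`r ≠ 0`). [cite: Balaban1985Averaging, (19) p.21] -/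
theorem ae_dist1_ne_specialUnitaryGroup [Nonempty n] {r : ℝ} (hr : r ≠ 0) :
    ∀ᵐ g ∂(HaarData.haar : Measure (Matrix.specialUnitaryGroup n ℂ)), dist1 g ≠ r := by
  rw [ae_iff]
  simpa only [not_not] using haar_setOf_dist1_eq_eq_zero_specialUnitaryGroup (n := n) hr

/-- **`Haar{u ∈ U(N) : dist1 u = r} = 0` for `r ≠ 0`** in the `GaugeGroup`∕`HaarData` currency of `UnitaryModel`.
[cite: Balaban1985Averaging, (19) p.21] [cite: BrockerTomDieck1985, IV (2.11) (proof)] -/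
theorem haar_setOf_dist1_eq_eq_zero_unitaryGroup {N : ℕ} [Nonempty (Fin N)] {r : ℝ} (hr : r ≠ 0) :
    (HaarData.haar : Measure (Matrix.unitaryGroup (Fin N) ℂ)) {u | dist1 u = r} = 0 := by
  haveI : (HaarData.haar : Measure (Matrix.unitaryGroup (Fin N) ℂ)).IsHaarMeasure := Measure.isHaarMeasure_haarMeasure _
  exact haar_unitaryGroup_setOf_norm_sub_one_eq_eq_zero _ hr

end Types

end Literature.MathematicalPhysics.QuantumFieldTheory.Balaban1983to89.HaarEigenvalueSphereNull

end
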